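import Mathlib
import Summits.Ventures.HodgeRepro2.T5RecordSatakeConductor
import Summits.Ventures.HodgeRepro2.T5ConductorZeroCharacter
import Summits.Ventures.HodgeRepro2.T5ConductorDualLatticeSplit
import Summits.Ventures.HodgeRepro2.T5IntegralGramBadSet

/-!
# THE LATTICE-MODEL DATA OF THE RECORD OUTSIDE `disc K`, IN ONE STATEMENT

Tier-5 support N3 / §G-N4.2 (seat p3, gen 84). File 326 stated §N3.10.3 outside `disc K` in one theorem (the
unramifiedness, clause (u2) for every `ψ`, the Hecke commutativity and the Satake chain). Files 327–330 added the
lattice-model side: the additive character of conductor exponent `0` exists, and the standard lattice is self-dual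
FOR THE CHARACTER at every good place, non-split (329, p8's `dualLattice` with a star preserving integrality) and
split (330, the swap star). This file states everything at once for the record's integral unimodular `H = M.map ι`
(whose `badSet` is empty, file `T5IntegralGramBadSet`):

* **`record_lattice_model_outside_discriminant`** — for every CM field `K`, every `M ∈ GL₃(𝓞_K)` hermitian over `K`,
  every place `v` of `K⁺` with `disc K ∉ v` above `v_p`: (i) SOME continuous non-trivial `ψ : ℚ_p → S¹` has
  `n(ψ) = 0` and `n(ψ ∘ Tr_{K⁺_v/ℚ_p}) = 0`; (ii) for EVERY such `ψ` and every `w ∣ v` of `K`: `e(w/v) = 1`,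
  `n(ψ_w) = 0` for `ψ_w = ψ ∘ Tr ∘ Tr`, and `𝒪_w` is `ψ_w`-self-dual; (iii) for every star on `K_w` preserving
  integrality, `{x : ψ_w(⟨x, 𝒪_w³⟩_{H_w}) = 1} = 𝒪_w³`; (iv) for the split pair `(H_w, H_wᵀ)` with the swap star,
  `𝒪_w³ × 𝒪_w³` is self-dual for `ψ_w`.

Together with file 326 (`record_hecke_conductor_outside_discriminant`, imported here) every local clause of
§N3.10.3 — (u1) unramified, (u2) the conductor of `ψ_v` with its witness, (u3)/(u4) self-dual lattices for the
character — and the Hecke commutativity hold at every place of `K⁺` not containing the one integer `disc K`.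

Nothing here is a statement about (P), theta lifts or L-values. §8(d): uses an L-value-free non-vanishing
device: NO.
-/

open IsDedekindDomain IsDedekindDomain.HeightOneSpectrum NumberField Matrix
open Summit.Ventures.HodgeRepro2.T5AdditiveConductor Summit.Ventures.HodgeRepro2.T5UnitaryGroupIsometry
  Summit.Ventures.HodgeRepro2.T5ConductorDualBall Summit.Ventures.HodgeRepro2.T5ConductorDualLattice
  Summit.Ventures.HodgeRepro2.T5ConductorDualLatticeSplit Summit.Ventures.HodgeRepro2.T5ConductorZeroCharacter
  Summit.Ventures.HodgeRepro2.T5GlobalLatticeAlmostAll Summit.Ventures.HodgeRepro2.T5SplitHermitianClass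
  Summit.Ventures.HodgeRepro2.T5IntegralGramBadSet

namespace Summit.Ventures.HodgeRepro2.T5RecordLatticeModelOutsideDiscriminant

variable (K : Type*) [Field K] [NumberField K]
variable {ι : Type*} [Fintype ι] [DecidableEq ι]
variable (M : Matrix ι ι (𝓞 K)) (hM : IsUnit M.det)

include hM in
/-- **THE LATTICE-MODEL DATA OF THE RECORD OUTSIDE `disc K`, IN ONE STATEMENT** (`H = M.map ι`, `M ∈ GL(𝓞_K)`; every
CM field `K`, stated for every number field): at every place `v` of `K⁺` with `disc K ∉ v`, above `v_p`:
(i) some continuous non-trivial `ψ : ℚ_p → S¹` has conductor exponent `0`, and so has `ψ ∘ Tr_{K⁺_v/ℚ_p}`;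
(ii) for every such `ψ` and every `w ∣ v`: `e(w/v) = 1`, `ψ_w := ψ ∘ Tr_{K⁺_v/ℚ_p} ∘ Tr_{K_w/K⁺_v}` has conductor
exponent `0`, and `𝒪_w` is `ψ_w`-self-dual; (iii) for every star on `K_w` preserving integrality, the standard
lattice `𝒪_w^n` is `ψ_w`-self-dual for `H_w`; (iv) `𝒪_w^n × 𝒪_w^n` is `ψ_w`-self-dual for the split pair
`(H_w, H_wᵀ)` with the swap star. -/
theorem record_lattice_model_outside_discriminant
    (v : HeightOneSpectrum (𝓞 (maximalRealSubfield K)))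
    (h : ((discr K : ℤ) : 𝓞 (maximalRealSubfield K)) ∉ v.asIdeal)
    (vp : HeightOneSpectrum (𝓞 ℚ)) [v.asIdeal.LiesOver vp.asIdeal] :
    (∃ ψ : AddChar (vp.adicCompletion ℚ) Circle, Continuous ψ ∧ (∃ y, ψ y ≠ 1) ∧
      conductorExp ψ (Valued.v : Valuation (vp.adicCompletion ℚ) (WithZero (Multiplicative ℤ))) = 0 ∧
      conductorExp (ψ.compAddMonoidHom
        (Algebra.trace (vp.adicCompletion ℚ) (v.adicCompletion (maximalRealSubfield K))).toAddMonoidHom)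
        (Valued.v : Valuation (v.adicCompletion (maximalRealSubfield K)) (WithZero (Multiplicative ℤ))) = 0) ∧
    ∀ (ψ : AddChar (vp.adicCompletion ℚ) Circle), Continuous ψ → (∃ y, ψ y ≠ 1) →
      conductorExp ψ (Valued.v : Valuation (vp.adicCompletion ℚ) (WithZero (Multiplicative ℤ))) = 0 →
      ∀ (w : HeightOneSpectrum (𝓞 K)) [w.asIdeal.LiesOver v.asIdeal],
        v.asIdeal.ramificationIdx' w.asIdeal = 1 ∧
        conductorExp (recordChar K vp v w ψ)
          (Valued.v : Valuation (w.adicCompletion K) (WithZero (Multiplicative ℤ))) = 0 ∧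
        (∀ x : w.adicCompletion K,
          (∀ y : w.adicCompletion K, Valued.v y ≤ 1 → recordChar K vp v w ψ (x * y) = 1) ↔ Valued.v x ≤ 1) ∧
        (∀ [StarRing (w.adicCompletion K)],
          (∀ z : w.adicCompletion K, IsLocalization.IsInteger (w.adicCompletionIntegers K) z →
            IsLocalization.IsInteger (w.adicCompletionIntegers K) (star z)) →
          ∀ x : ι → w.adicCompletion K,
            (∀ y ∈ stdLattice (w.adicCompletionIntegers K),
              recordChar K vp v w ψ
                (sesqForm (((algebraMap (𝓞 K) K).mapMatrix M).map (algebraMap K (w.adicCompletion K))) x y) = 1) ↔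
              x ∈ stdLattice (w.adicCompletionIntegers K)) ∧
        (letI := swapStarRing (w.adicCompletion K)
          ∀ x : ι → w.adicCompletion K × w.adicCompletion K,
            (∀ y : ι → w.adicCompletion K × w.adicCompletion K,
              (∀ i, Valued.v (y i).1 ≤ 1 ∧ Valued.v (y i).2 ≤ 1) →
              recordChar K vp v w ψ
                  (sesqForm (pairMatrix (((algebraMap (𝓞 K) K).mapMatrix M).map (algebraMap K (w.adicCompletion K)))
                    (((algebraMap (𝓞 K) K).mapMatrix M).map (algebraMap K (w.adicCompletion K)))ᵀ) x y).1 *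
                recordChar K vp v w ψ
                  (sesqForm (pairMatrix (((algebraMap (𝓞 K) K).mapMatrix M).map (algebraMap K (w.adicCompletion K)))
                    (((algebraMap (𝓞 K) K).mapMatrix M).map (algebraMap K (w.adicCompletion K)))ᵀ) x y).2 = 1) ↔
              ∀ i, Valued.v (x i).1 ≤ 1 ∧ Valued.v (x i).2 ≤ 1) := by
  refine ⟨exists_addChar_conductorExp_comp_trace_eq_zero_cm K vp v h, ?_⟩
  intro ψ hψ hne h0 w _
  have hdet : IsUnit ((algebraMap (𝓞 K) K).mapMatrix M).det := isUnit_det_mapMatrix M hM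
  have hw' : w ∉ badSet ((algebraMap (𝓞 K) K).mapMatrix M) := notMem_badSet_mapMatrix M hM w
  refine ⟨ramificationIdx'_eq_one_of_discr_notMem K v w h,
    conductorExp_recordChar_eq_zero K vp v w h ψ hψ hne h0,
    fun x => forall_mul_le_one_iff_record K v w vp h ψ hψ hne h0 x, ?_, ?_⟩
  · intro _ hstar x
    exact forall_addChar_iff_mem_stdLattice_of_notMem_badSet w (recordChar K vp v w ψ)
      (continuous_recordChar K vp v w ψ hψ) (exists_recordChar_ne_one K vp v w ψ hne)
      (conductorExp_recordChar_eq_zero K vp v w h ψ hψ hne h0) hstar hdet hw' x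
  · intro x
    exact forall_recordChar_pair_iff_forall_val_le_one K vp v w h hdet hw' ψ hψ hne h0 x

end Summit.Ventures.HodgeRepro2.T5RecordLatticeModelOutsideDiscriminant
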